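import Literature.NumberTheory.Sieve.GoldstonPintzYildirimCounting
import HarnessLib

/-!
# Goldston–Pintz–Yıldırım, *Primes in tuples I*, §7: (7.3)–(7.6) for two tuples

Trunk: NumberTheory / Sieve. Continuation of `GoldstonPintzYildirimCounting` (§6, one tuple) to the
setting of GPY §7 (arXiv:math/0508185, p. 14), the opening of the proof of Proposition 1 in general:
for squarefree `d = a₁a₁₂`, `e = a₂a₁₂` the solutions of `d ∣ P_{H₁}(n)`, `e ∣ P_{H₂}(n)` form
`ν_{a₁}(H₁) ν_{a₂}(H₂) ν̄_{a₁₂}(H₁ ∩̄ H₂)` residue classes modulo `[d, e] = a₁a₂a₁₂`, where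
`ν̄_p(H₁ ∩̄ H₂) = ν_p(H₁) + ν_p(H₂) − ν_p(H₁ ∪ H₂)` ((7.5)). Everything here is PROVED.

* `Literature.GPY.nuBar H₁ H₂ p` — (7.5); `nuBar_eq_card_inter`;
* `Literature.GPY.nuJoint H₁ H₂ d e = ∏_{p ∣ [d,e]} nuJointPrime` — the product of local factors
  (`ν_p(H₁)`, `ν_p(H₂)` or `ν̄_p` according as `p ∣ a₁`, `a₂`, `a₁₂`);
* `card_filter_range_lcm` — there are exactly `nuJoint` solutions modulo `[d, e]` (CRT);
* `abs_card_filter_dvd_and_sub_le` — **(7.4)**: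
  `|#{1 ≤ n ≤ N : d ∣ P_{H₁}(n), e ∣ P_{H₂}(n)} − nuJoint · N/[d,e]| ≤ nuJoint`;
* `nuJoint_eq` — `nuJoint = ν_{a₁}(H₁) ν_{a₂}(H₂) ν̄_{a₁₂}(H₁ ∩̄ H₂)` with `a₁₂ = (d,e)`,
  `a₁ = d/a₁₂`, `a₂ = e/a₁₂`, exactly the coefficient printed in (7.4)/(7.6).

* `sum_lambdaR_mul_eq` — **(7.3)**; `mainTR₂ R H₁ H₂ ℓ₁ ℓ₂ = T_R(ℓ₁, ℓ₂; H₁, H₂)` (over pairs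
  `(d,e)`);
* `abs_sum_lambdaR_mul_sub_le`, `abs_sum_lambdaR_mul_sub_le'` — **(7.6)**:
  `|S_R(N; H₁,H₂,ℓ₁,ℓ₂) − N T_R| ≤ ((log R)^{M'}/((k₁+ℓ₁)!(k₂+ℓ₂)!)) (∑♭_{q≤R} d_k(q))²`
  `≤ … (R (k+log R)^k)²`
  (`k = k₁+k₂`, `M' = k₁+ℓ₁+k₂+ℓ₂`; explicit in place of the printed `O(R²(3 log R)^{3k+M})`).

Next step of the source (not here): (7.7)–(7.15), `T_R` as the double contour integral of
`F(s₁,s₂) R^{s₁+s₂}/(s₁^{k₁+ℓ₁+1} s₂^{k₂+ℓ₂+1})` and Lemma 3.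

## References

* D. A. Goldston, J. Pintz, C. Y. Yıldırım, *Primes in tuples. I*, Ann. of Math. (2) 170 (2009),
  819–862 = arXiv:math/0508185, §7, (7.3)–(7.6), p. 14. [cite: GoldstonPintzYildirim2009]
-/

noncomputable section

open Finset
open scoped ArithmeticFunction.Moebius ArithmeticFunction.omega

namespace Literature.NumberTheory.Sieve.GPY


/-- `ν_p(H₁ ∪ H₂) ≤ ν_p(H₁) + ν_p(H₂)`. [folklore] -/
theorem nuPrime_union_le (H₁ H₂ : Finset ℕ) (p : ℕ) :
    nuPrime (H₁ ∪ H₂) p ≤ nuPrime H₁ p + nuPrime H₂ p := by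
  unfold nuPrime
  rw [Finset.image_union]
  exact Finset.card_union_le _ _

/-- GPY (7.5): `ν̄_p(H₁ ∩̄ H₂) := ν_p(H₁) + ν_p(H₂) − ν_p(H)`, `H = H₁ ∪ H₂` — the number of residue
classes modulo `p` common to `H₁` and `H₂` ("we take intersections modulo `p`";
`nuBar_eq_card_inter`). [cite: GoldstonPintzYildirim2009, Section 7 eq. 7.5] -/
def nuBar (H₁ H₂ : Finset ℕ) (p : ℕ) : ℕ := nuPrime H₁ p + nuPrime H₂ p - nuPrime (H₁ ∪ H₂) p

/-- `ν̄_p(H₁ ∩̄ H₂) = #((H₁ mod p) ∩ (H₂ mod p))` (inclusion–exclusion), i.e.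
`ν_p(H₁(p) ∩ H₂(p))` in the notation of GPY p. 14.
[cite: GoldstonPintzYildirim2009, Section 7 eq. 7.5] -/
theorem nuBar_eq_card_inter (H₁ H₂ : Finset ℕ) (p : ℕ) :
    nuBar H₁ H₂ p = #((H₁.image fun h => h % p) ∩ (H₂.image fun h => h % p)) := by
  unfold nuBar nuPrime
  rw [Finset.image_union]
  have := Finset.card_union_add_card_inter (H₁.image fun h => h % p) (H₂.image fun h => h % p)
  omega

/-- "If `p ∣ a₁₂`, then from the two divisibility conditions we have `ν_p(H₁(p) ∩ H₂(p))`
solutions for `n` modulo `p`" (GPY §7 before (7.5)):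
`#{r < p : p ∣ P_{H₁}(r), p ∣ P_{H₂}(r)} = ν̄_p(H₁ ∩̄ H₂)`.
[cite: GoldstonPintzYildirim2009, Section 7 eq. 7.5] -/
theorem card_filter_range_prime_dvd_and {p : ℕ} (hp : p.Prime) (H₁ H₂ : Finset ℕ) :
    #((range p).filter fun r => p ∣ tuplePoly H₁ r ∧ p ∣ tuplePoly H₂ r) = nuBar H₁ H₂ p := by
  -- inclusion–exclusion with the single counts and the count for `H₁ ∪ H₂`
  have hP : ∀ r, p ∣ tuplePoly (H₁ ∪ H₂) r ↔ p ∣ tuplePoly H₁ r ∨ p ∣ tuplePoly H₂ r := by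
    intro r
    simp only [prime_dvd_tuplePoly_iff hp, Finset.mem_union]
    constructor
    · rintro ⟨h, hh | hh, hd⟩
      · exact Or.inl ⟨h, hh, hd⟩
      · exact Or.inr ⟨h, hh, hd⟩
    · rintro (⟨h, hh, hd⟩ | ⟨h, hh, hd⟩)
      · exact ⟨h, Or.inl hh, hd⟩
      · exact ⟨h, Or.inr hh, hd⟩
  have h1 := card_filter_range_prime_dvd hp H₁
  have h2 := card_filter_range_prime_dvd hp H₂
  have h12 := card_filter_range_prime_dvd hp (H₁ ∪ H₂)
  have hunion : (range p).filter (fun r => p ∣ tuplePoly (H₁ ∪ H₂) r) =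
      (range p).filter (fun r => p ∣ tuplePoly H₁ r) ∪
        (range p).filter (fun r => p ∣ tuplePoly H₂ r) := by
    rw [← Finset.filter_or]
    exact Finset.filter_congr fun r _ => hP r
  have hinter : (range p).filter (fun r => p ∣ tuplePoly H₁ r ∧ p ∣ tuplePoly H₂ r) =
      (range p).filter (fun r => p ∣ tuplePoly H₁ r) ∩
        (range p).filter (fun r => p ∣ tuplePoly H₂ r) := by
    rw [← Finset.filter_and]
  rw [hunion] at h12
  have hie := Finset.card_union_add_card_inter ((range p).filter (fun r => p ∣ tuplePoly H₁ r))
    ((range p).filter (fun r => p ∣ tuplePoly H₂ r))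
  rw [hinter, nuBar]
  omega

/-- The local factor at a prime `p ∣ [d, e]` of the number of solutions modulo `[d, e]` of
`d ∣ P_{H₁}(n)`, `e ∣ P_{H₂}(n)`: `ν_p(H₁)` if `p ∣ d`, `p ∤ e` (i.e. `p ∣ a₁`), `ν_p(H₂)` if
`p ∤ d`, `p ∣ e` (`p ∣ a₂`), `ν̄_p(H₁ ∩̄ H₂)` if `p ∣ (d, e) = a₁₂` (GPY §7, `d = a₁a₁₂`,
`e = a₂a₁₂`).
[cite: GoldstonPintzYildirim2009, Section 7 eq. 7.4] -/
def nuJointPrime (H₁ H₂ : Finset ℕ) (d e p : ℕ) : ℕ :=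
  if p ∣ d then (if p ∣ e then nuBar H₁ H₂ p else nuPrime H₁ p) else nuPrime H₂ p

/-- The number of solutions modulo `[d, e] = a₁a₂a₁₂` of `d ∣ P_{H₁}(n)`, `e ∣ P_{H₂}(n)` as the
product of its local factors, `= ν_{a₁}(H₁) ν_{a₂}(H₂) ν̄_{a₁₂}(H₁ ∩̄ H₂)` in the notation of GPY
(7.4)/(7.6) (the three groups of primes `p ∣ a₁`, `p ∣ a₂`, `p ∣ a₁₂` of `nuJointPrime`;
`card_filter_range_lcm`).
[cite: GoldstonPintzYildirim2009, Section 7 eq. 7.4] -/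
def nuJoint (H₁ H₂ : Finset ℕ) (d e : ℕ) : ℕ :=
  ∏ p ∈ (Nat.lcm d e).primeFactors, nuJointPrime H₁ H₂ d e p

/-- For squarefree `d`, `e`: `d ∣ P₁(r) ∧ e ∣ P₂(r)` iff for every prime `p ∣ [d, e]`,
`(p ∣ d → p ∣ P₁(r)) ∧ (p ∣ e → p ∣ P₂(r))`. [folklore] -/
theorem dvd_and_dvd_iff {d e : ℕ} (hd : Squarefree d) (he : Squarefree e) (H₁ H₂ : Finset ℕ)
    (r : ℕ) :
    (d ∣ tuplePoly H₁ r ∧ e ∣ tuplePoly H₂ r) ↔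
      ∀ p ∈ (Nat.lcm d e).primeFactors,
        (p ∣ d → p ∣ tuplePoly H₁ r) ∧ (p ∣ e → p ∣ tuplePoly H₂ r) := by
  have hd0 := hd.ne_zero
  have he0 := he.ne_zero
  rw [squarefree_dvd_iff hd, squarefree_dvd_iff he]
  constructor
  · rintro ⟨h1, h2⟩ p hp
    have hpp := Nat.prime_of_mem_primeFactors hp
    exact ⟨fun hpd => h1 p (Nat.mem_primeFactors.2 ⟨hpp, hpd, hd0⟩),
      fun hpe => h2 p (Nat.mem_primeFactors.2 ⟨hpp, hpe, he0⟩)⟩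
  · intro h
    constructor
    · intro p hp
      have hpp := Nat.prime_of_mem_primeFactors hp
      have hpd := Nat.dvd_of_mem_primeFactors hp
      exact (h p (Nat.mem_primeFactors.2 ⟨hpp, hpd.trans (Nat.dvd_lcm_left d e),
        Nat.lcm_ne_zero hd0 he0⟩)).1 hpd
    · intro p hp
      have hpp := Nat.prime_of_mem_primeFactors hp
      have hpe := Nat.dvd_of_mem_primeFactors hp
      exact (h p (Nat.mem_primeFactors.2 ⟨hpp, hpe.trans (Nat.dvd_lcm_right d e),
        Nat.lcm_ne_zero hd0 he0⟩)).2 hpe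

/-- Each local condition is `p`-periodic in `r`. [folklore] -/
theorem jointCond_mod_iff (H₁ H₂ : Finset ℕ) (d e p r : ℕ) :
    ((p ∣ d → p ∣ tuplePoly H₁ (r % p)) ∧ (p ∣ e → p ∣ tuplePoly H₂ (r % p))) ↔
      ((p ∣ d → p ∣ tuplePoly H₁ r) ∧ (p ∣ e → p ∣ tuplePoly H₂ r)) := by
  rw [prime_dvd_tuplePoly_mod_iff, prime_dvd_tuplePoly_mod_iff]

/-- The local count equals `nuJointPrime` (a prime `p` dividing `d` or `e`). [folklore] -/
theorem card_filter_range_jointCond {p : ℕ} (hp : p.Prime) (H₁ H₂ : Finset ℕ) {d e : ℕ}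
    (hpde : p ∣ d ∨ p ∣ e) :
    #((range p).filter fun x => (p ∣ d → p ∣ tuplePoly H₁ x) ∧ (p ∣ e → p ∣ tuplePoly H₂ x)) =
      nuJointPrime H₁ H₂ d e p := by
  unfold nuJointPrime
  by_cases hd : p ∣ d <;> by_cases he : p ∣ e
  · rw [if_pos hd, if_pos he, ← card_filter_range_prime_dvd_and hp H₁ H₂]
    congr 1
    exact Finset.filter_congr fun x _ => by simp [hd, he]
  · rw [if_pos hd, if_neg he, ← card_filter_range_prime_dvd hp H₁]
    congr 1
    exact Finset.filter_congr fun x _ => by simp [hd, he]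
  · rw [if_neg hd, ← card_filter_range_prime_dvd hp H₂]
    congr 1
    exact Finset.filter_congr fun x _ => by simp [hd, he]
  · exact absurd hpde (by tauto)

/-- For squarefree `d`, `e`: `#{r < [d, e] : d ∣ P_{H₁}(r) ∧ e ∣ P_{H₂}(r)} = nuJoint H₁ H₂ d e` —
"we get `ν_{a₁}(H₁)` solutions for `n` modulo `a₁`, `ν_{a₂}(H₂)` modulo `a₂`" and `ν̄_p` modulo
`p ∣ a₁₂` (GPY §7), assembled by the Chinese remainder theorem (`sum_range_prod_eq_prod_sum`).
[cite: GoldstonPintzYildirim2009, Section 7 eq. 7.4] -/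
theorem card_filter_range_lcm {d e : ℕ} (hd : Squarefree d) (he : Squarefree e)
    (H₁ H₂ : Finset ℕ) :
    #((range (Nat.lcm d e)).filter fun r => d ∣ tuplePoly H₁ r ∧ e ∣ tuplePoly H₂ r) =
      nuJoint H₁ H₂ d e := by
  classical
  have hd0 := hd.ne_zero
  have he0 := he.ne_zero
  set m := Nat.lcm d e with hmdef
  have hm0 : m ≠ 0 := Nat.lcm_ne_zero hd0 he0
  -- `m` is squarefree
  have hmsq : Squarefree m := by
    rw [Nat.squarefree_iff_factorization_le_one hm0]
    intro p
    rw [hmdef, Nat.factorization_lcm hd0 he0, Finsupp.sup_apply]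
    exact sup_le ((Nat.squarefree_iff_factorization_le_one hd0).mp hd p)
      ((Nat.squarefree_iff_factorization_le_one he0).mp he p)
  set S := m.primeFactors with hSdef
  have hS : ∀ p ∈ S, p.Prime := fun p hp => Nat.prime_of_mem_primeFactors hp
  have hprod : ∏ p ∈ S, p = m := Nat.prod_primeFactors_of_squarefree hmsq
  have hpde : ∀ p ∈ S, p ∣ d ∨ p ∣ e := fun p hp =>
    (Nat.Prime.dvd_mul (Nat.prime_of_mem_primeFactors hp)).1
      ((Nat.dvd_of_mem_primeFactors hp).trans (Nat.lcm_dvd_mul d e))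
  set g : ℕ → ℕ → ℝ := fun p r =>
    if (p ∣ d → p ∣ tuplePoly H₁ r) ∧ (p ∣ e → p ∣ tuplePoly H₂ r) then 1 else 0 with hgdef
  have hg : ∀ p ∈ S, ∀ t, g p (t % p) = g p t := by
    intro p _ t
    simp only [hgdef, jointCond_mod_iff]
  have key := sum_range_prod_eq_prod_sum S hS g hg
  rw [hprod] at key
  have hL : ∀ r, ∏ p ∈ S, g p r = if d ∣ tuplePoly H₁ r ∧ e ∣ tuplePoly H₂ r then 1 else 0 := by
    intro r
    simp only [hgdef]
    rw [Finset.prod_boole]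
    congr 1
    exact propext (dvd_and_dvd_iff hd he H₁ H₂ r).symm
  have hRp : ∀ p ∈ S, ∑ x ∈ range p, g p x = nuJointPrime H₁ H₂ d e p := by
    intro p hp
    simp only [hgdef]
    rw [Finset.sum_boole, card_filter_range_jointCond (hS p hp) H₁ H₂ (hpde p hp)]
  simp_rw [hL] at key
  rw [Finset.sum_boole, Finset.prod_congr rfl hRp] at key
  unfold nuJoint
  exact_mod_cast key

/-- `d ∣ P₁(n) ∧ e ∣ P₂(n)` is `[d, e]`-periodic in `n` (squarefree `d`, `e`). [folklore] -/
theorem dvd_and_dvd_mod_iff {d e : ℕ} (hd : Squarefree d) (he : Squarefree e) (H₁ H₂ : Finset ℕ)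
    (t : ℕ) :
    (d ∣ tuplePoly H₁ (t % Nat.lcm d e) ∧ e ∣ tuplePoly H₂ (t % Nat.lcm d e)) ↔
      (d ∣ tuplePoly H₁ t ∧ e ∣ tuplePoly H₂ t) := by
  rw [← dvd_tuplePoly_mod_iff hd H₁ (t % Nat.lcm d e),
    ← dvd_tuplePoly_mod_iff he H₂ (t % Nat.lcm d e),
    Nat.mod_mod_of_dvd t (Nat.dvd_lcm_left d e), Nat.mod_mod_of_dvd t (Nat.dvd_lcm_right d e),
    dvd_tuplePoly_mod_iff hd, dvd_tuplePoly_mod_iff he]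

/-- **GPY (7.4)**: `∑_{1 ≤ n ≤ N, d ∣ P_{H₁}(n), e ∣ P_{H₂}(n)} 1 =
ν_{a₁}(H₁)ν_{a₂}(H₂)ν̄_{a₁₂}(H₁ ∩̄ H₂) (N/(a₁a₂a₁₂) + O(1))` for squarefree `d = a₁a₁₂`,
`e = a₂a₁₂`, with the `O(1)` explicit:
`|#{…} − nuJoint · N/[d, e]| ≤ nuJoint`. [cite: GoldstonPintzYildirim2009, Section 7 eq. 7.4] -/
theorem abs_card_filter_dvd_and_sub_le {d e : ℕ} (hd : Squarefree d) (he : Squarefree e)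
    (H₁ H₂ : Finset ℕ) (N : ℕ) :
    |(#((Icc 1 N).filter fun n => d ∣ tuplePoly H₁ n ∧ e ∣ tuplePoly H₂ n) : ℝ) -
        nuJoint H₁ H₂ d e * ((N : ℝ) / Nat.lcm d e)| ≤ nuJoint H₁ H₂ d e := by
  classical
  set m := Nat.lcm d e with hmdef
  have hm0 : 0 < m := Nat.pos_of_ne_zero (Nat.lcm_ne_zero hd.ne_zero he.ne_zero)
  have hper : ∀ a k : ℕ,
      #((Ico a (a + k * m)).filter fun n => d ∣ tuplePoly H₁ n ∧ e ∣ tuplePoly H₂ n) =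
        k * nuJoint H₁ H₂ d e := by
    intro a k
    rw [card_filter_Ico_of_periodic hm0 a k (fun n => d ∣ tuplePoly H₁ n ∧ e ∣ tuplePoly H₂ n)
      (fun t => dvd_and_dvd_mod_iff hd he H₁ H₂ t), card_filter_range_lcm hd he]
  have hlo : N / m * nuJoint H₁ H₂ d e ≤
      #((Icc 1 N).filter fun n => d ∣ tuplePoly H₁ n ∧ e ∣ tuplePoly H₂ n) := by
    rw [← hper 1 (N / m)]
    have hqd : N / m * m ≤ N := Nat.div_mul_le_self N m
    exact card_le_card (filter_subset_filter _ fun x hx => by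
      rw [Finset.mem_Ico] at hx; rw [Finset.mem_Icc]; omega)
  have hhi : #((Icc 1 N).filter fun n => d ∣ tuplePoly H₁ n ∧ e ∣ tuplePoly H₂ n) ≤
      (N / m + 1) * nuJoint H₁ H₂ d e := by
    rw [← hper 1 (N / m + 1)]
    have hlt : N < (N / m + 1) * m := by
      rw [Nat.add_mul, one_mul]; exact Nat.lt_div_mul_add hm0
    exact card_le_card (filter_subset_filter _ fun x hx => by
      rw [Finset.mem_Icc] at hx; rw [Finset.mem_Ico]; omega)
  have hm0' : (0 : ℝ) < m := by exact_mod_cast hm0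
  have h1' : ((N / m : ℕ) : ℝ) * nuJoint H₁ H₂ d e ≤
      #((Icc 1 N).filter fun n => d ∣ tuplePoly H₁ n ∧ e ∣ tuplePoly H₂ n) := by exact_mod_cast hlo
  have h2' : (#((Icc 1 N).filter fun n => d ∣ tuplePoly H₁ n ∧ e ∣ tuplePoly H₂ n) : ℝ) ≤
      ((N / m : ℕ) + 1) * nuJoint H₁ H₂ d e := by exact_mod_cast hhi
  have hfloor : ((N / m : ℕ) : ℝ) ≤ (N : ℝ) / m := Nat.cast_div_le
  have hfloor' : (N : ℝ) / m - 1 < ((N / m : ℕ) : ℝ) := by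
    have h := Nat.lt_div_mul_add hm0 (a := N)
    have h' : (N : ℝ) < ((N / m : ℕ) : ℝ) * m + m := by exact_mod_cast h
    rw [div_sub_one hm0'.ne', div_lt_iff₀ hm0']
    linarith
  have hν : (0 : ℝ) ≤ nuJoint H₁ H₂ d e := Nat.cast_nonneg _
  rw [abs_le]
  constructor <;> nlinarith

/-! ### Identification with GPY's `ν_{a₁}(H₁) ν_{a₂}(H₂) ν̄_{a₁₂}(H₁ ∩̄ H₂)` -/

/-- For squarefree `d` and `g = (d, e)`: a prime divides `a₁ = d/g` iff it divides `d` but not `e`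
(`a₁` and `a₁₂ = g` are coprime since `d = a₁a₁₂` is squarefree). [folklore] -/
theorem prime_dvd_div_gcd_iff {d e p : ℕ} (hd : Squarefree d) (hp : p.Prime) :
    p ∣ d / Nat.gcd d e ↔ p ∣ d ∧ ¬ p ∣ e := by
  set g := Nat.gcd d e with hgdef
  have hg0 : 0 < g := Nat.gcd_pos_of_pos_left e (Nat.pos_of_ne_zero hd.ne_zero)
  have hdg : d / g * g = d := Nat.div_mul_cancel (Nat.gcd_dvd_left d e)
  have hcop : Nat.Coprime (d / g) g := by
    apply Nat.coprime_of_squarefree_mul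
    rw [hdg]; exact hd
  constructor
  · intro h
    refine ⟨h.trans (Nat.div_dvd_of_dvd (Nat.gcd_dvd_left d e)), fun hpe => ?_⟩
    have hpg : p ∣ g := Nat.dvd_gcd (h.trans (Nat.div_dvd_of_dvd (Nat.gcd_dvd_left d e))) hpe
    have : p ∣ Nat.gcd (d / g) g := Nat.dvd_gcd h hpg
    rw [hcop] at this
    exact hp.one_lt.ne' (Nat.dvd_one.1 this)
  · rintro ⟨hpd, hpe⟩
    have : p ∣ d / g * g := by rw [hdg]; exact hpd
    rcases (Nat.Prime.dvd_mul hp).1 this with h | h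
    · exact h
    · exact absurd (h.trans (Nat.gcd_dvd_right d e)) hpe

/-- **GPY's form of the joint count** ((7.4)/(7.6)): for squarefree `d = a₁a₁₂`, `e = a₂a₁₂` with
`a₁₂ = (d, e)`, `a₁ = d/a₁₂`, `a₂ = e/a₁₂` (pairwise coprime),
`nuJoint H₁ H₂ d e = ν_{a₁}(H₁) · ν_{a₂}(H₂) · ∏_{p ∣ a₁₂} ν̄_p(H₁ ∩̄ H₂)`, the last factor being
the multiplicative extension `ν̄_{a₁₂}(H₁ ∩̄ H₂)` of (7.5).
[cite: GoldstonPintzYildirim2009, Section 7 eq. 7.4] -/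
theorem nuJoint_eq {d e : ℕ} (hd : Squarefree d) (he : Squarefree e) (H₁ H₂ : Finset ℕ) :
    nuJoint H₁ H₂ d e = nu H₁ (d / Nat.gcd d e) * nu H₂ (e / Nat.gcd d e) *
      ∏ p ∈ (Nat.gcd d e).primeFactors, nuBar H₁ H₂ p := by
  classical
  have hd0 := hd.ne_zero
  have he0 := he.ne_zero
  set g := Nat.gcd d e with hgdef
  have hg0 : g ≠ 0 := (Nat.gcd_pos_of_pos_left e (Nat.pos_of_ne_zero hd0)).ne'
  have hdg0 : d / g ≠ 0 := (Nat.div_pos (Nat.le_of_dvd (Nat.pos_of_ne_zero hd0)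
    (Nat.gcd_dvd_left d e)) (Nat.pos_of_ne_zero hg0)).ne'
  have heg0 : e / g ≠ 0 := (Nat.div_pos (Nat.le_of_dvd (Nat.pos_of_ne_zero he0)
    (Nat.gcd_dvd_right d e)) (Nat.pos_of_ne_zero hg0)).ne'
  have hl0 : Nat.lcm d e ≠ 0 := Nat.lcm_ne_zero hd0 he0
  -- membership descriptions
  have hA₁ : ∀ p, p ∈ (d / g).primeFactors ↔ p.Prime ∧ p ∣ d ∧ ¬ p ∣ e := fun p => by
    rw [Nat.mem_primeFactors_of_ne_zero hdg0]
    constructor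
    · rintro ⟨hp, h⟩; exact ⟨hp, (prime_dvd_div_gcd_iff hd hp).1 h⟩
    · rintro ⟨hp, h⟩; exact ⟨hp, (prime_dvd_div_gcd_iff hd hp).2 h⟩
  have hA₂ : ∀ p, p ∈ (e / g).primeFactors ↔ p.Prime ∧ p ∣ e ∧ ¬ p ∣ d := fun p => by
    rw [Nat.mem_primeFactors_of_ne_zero heg0, hgdef, Nat.gcd_comm]
    constructor
    · rintro ⟨hp, h⟩; exact ⟨hp, (prime_dvd_div_gcd_iff he hp).1 h⟩
    · rintro ⟨hp, h⟩; exact ⟨hp, (prime_dvd_div_gcd_iff he hp).2 h⟩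
  have hA₁₂ : ∀ p, p ∈ g.primeFactors ↔ p.Prime ∧ p ∣ d ∧ p ∣ e := fun p => by
    rw [Nat.mem_primeFactors_of_ne_zero hg0, hgdef, Nat.dvd_gcd_iff]
  have hS : ∀ p, p ∈ (Nat.lcm d e).primeFactors ↔ p.Prime ∧ (p ∣ d ∨ p ∣ e) := fun p => by
    rw [Nat.mem_primeFactors_of_ne_zero hl0]
    constructor
    · rintro ⟨hp, h⟩
      exact ⟨hp, (Nat.Prime.dvd_mul hp).1 (h.trans (Nat.lcm_dvd_mul d e))⟩
    · rintro ⟨hp, h | h⟩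
      · exact ⟨hp, h.trans (Nat.dvd_lcm_left d e)⟩
      · exact ⟨hp, h.trans (Nat.dvd_lcm_right d e)⟩
  -- the partition
  have hunion : (Nat.lcm d e).primeFactors =
      ((d / g).primeFactors ∪ (e / g).primeFactors) ∪ g.primeFactors := by
    ext p
    simp only [Finset.mem_union, hA₁, hA₂, hA₁₂, hS]
    tauto
  have hdisj1 : Disjoint (d / g).primeFactors (e / g).primeFactors := by
    rw [Finset.disjoint_left]
    intro p h1 h2
    rw [hA₁] at h1; rw [hA₂] at h2
    exact h1.2.2 h2.2.1
  have hdisj2 : Disjoint ((d / g).primeFactors ∪ (e / g).primeFactors) g.primeFactors := by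
    rw [Finset.disjoint_left]
    intro p h12 h3
    rw [hA₁₂] at h3
    rcases Finset.mem_union.1 h12 with h1 | h2
    · rw [hA₁] at h1; exact h1.2.2 h3.2.2
    · rw [hA₂] at h2; exact h2.2.2 h3.2.1
  unfold nuJoint nu
  rw [hunion, Finset.prod_union hdisj2, Finset.prod_union hdisj1]
  congr 1
  · congr 1
    · refine Finset.prod_congr rfl fun p hp => ?_
      rw [hA₁] at hp
      simp [nuJointPrime, hp.2.1, hp.2.2]
    · refine Finset.prod_congr rfl fun p hp => ?_
      rw [hA₂] at hp
      simp [nuJointPrime, hp.2.2]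
  · refine Finset.prod_congr rfl fun p hp => ?_
    rw [hA₁₂] at hp
    simp [nuJointPrime, hp.2.1, hp.2.2]

/-! ### (7.3) and (7.6) -/

/-- The coefficient bound used for the error term of (7.6):
`nuJoint ≤ k^{ω(d)} k^{ω(e)} = d_k(d) d_k(e)` with `k = k₁ + k₂ ≥ 1` (every local factor is
`≤ max(ν_p(H₁), ν_p(H₂)) ≤ k`; GPY bound it by `d_k(q)`, `q = a₁a₂a₁₂`, and count the
`(a₁,a₂,a₁₂)` with `d_3(q)`). [cite: GoldstonPintzYildirim2009, Section 7 eq. 7.6] -/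
theorem nuJoint_le (H₁ H₂ : Finset ℕ) (hk : 1 ≤ #H₁ + #H₂) {d e : ℕ} (hd : d ≠ 0) (he : e ≠ 0) :
    (nuJoint H₁ H₂ d e : ℝ) ≤ dGen (#H₁ + #H₂) d * dGen (#H₁ + #H₂) e := by
  classical
  unfold nuJoint dGen
  have hω : ∀ n : ℕ, ω n = n.primeFactors.card := fun n => by
    rw [ArithmeticFunction.cardDistinctFactors_apply, Nat.primeFactors, List.card_toFinset]
  rw [hω, hω]
  set k : ℕ := #H₁ + #H₂ with hkdef
  have hk1 : (1 : ℝ) ≤ k := by exact_mod_cast hk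
  set S := (Nat.lcm d e).primeFactors with hSdef
  have hsub1 : S.filter (fun p => p ∣ d) ⊆ d.primeFactors := by
    intro p hp
    rw [Finset.mem_filter] at hp
    exact Nat.mem_primeFactors.2 ⟨Nat.prime_of_mem_primeFactors hp.1, hp.2, hd⟩
  have hsub2 : S.filter (fun p => ¬ p ∣ d) ⊆ e.primeFactors := by
    intro p hp
    rw [Finset.mem_filter] at hp
    have hpp := Nat.prime_of_mem_primeFactors hp.1
    have : p ∣ d ∨ p ∣ e :=
      (Nat.Prime.dvd_mul hpp).1 ((Nat.dvd_of_mem_primeFactors hp.1).trans (Nat.lcm_dvd_mul d e))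
    exact Nat.mem_primeFactors.2 ⟨hpp, this.resolve_left hp.2, he⟩
  have hloc : ∀ p, (nuJointPrime H₁ H₂ d e p : ℝ) ≤ k := by
    intro p
    have h1 := nuPrime_le_card H₁ p
    have h2 := nuPrime_le_card H₂ p
    have h3 : nuBar H₁ H₂ p ≤ #H₁ := by
      rw [nuBar_eq_card_inter]
      exact (Finset.card_le_card Finset.inter_subset_left).trans Finset.card_image_le
    unfold nuJointPrime
    split_ifs <;> push_cast [hkdef] <;> norm_cast <;> omega
  rw [← Finset.prod_filter_mul_prod_filter_not S (fun p => p ∣ d)]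
  push_cast
  have hbound : ∀ T : Finset ℕ, ∏ p ∈ T, (nuJointPrime H₁ H₂ d e p : ℝ) ≤ (k : ℝ) ^ T.card := by
    intro T
    calc ∏ p ∈ T, (nuJointPrime H₁ H₂ d e p : ℝ) ≤ ∏ _p ∈ T, (k : ℝ) :=
          Finset.prod_le_prod (fun p _ => by positivity) fun p _ => hloc p
      _ = (k : ℝ) ^ T.card := Finset.prod_const _
  have h1 : ∏ p ∈ S.filter (fun p => p ∣ d), (nuJointPrime H₁ H₂ d e p : ℝ) ≤
      (k : ℝ) ^ d.primeFactors.card :=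
    (hbound _).trans (pow_le_pow_right₀ hk1 (Finset.card_le_card hsub1))
  have h2 : ∏ p ∈ S.filter (fun p => ¬ p ∣ d), (nuJointPrime H₁ H₂ d e p : ℝ) ≤
      (k : ℝ) ^ e.primeFactors.card :=
    (hbound _).trans (pow_le_pow_right₀ hk1 (Finset.card_le_card hsub2))
  push_cast [hkdef] at h1 h2 ⊢
  exact mul_le_mul h1 h2 (Finset.prod_nonneg fun p _ => by positivity) (by positivity)

/-- `Λ_R(n;H₁,ℓ₁)Λ_R(n;H₂,ℓ₂)` expanded over pairs `(d, e)`, `d, e ≤ R`, of divisors of `P_{H₁}(n)`,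
`P_{H₂}(n)` (one summand of (7.3)). [cite: GoldstonPintzYildirim2009, Section 7 eq. 7.3] -/
theorem lambdaR_mul_lambdaR_eq (R : ℝ) (H₁ H₂ : Finset ℕ) (ℓ₁ ℓ₂ : ℕ) {n : ℕ} (hn : 1 ≤ n) :
    lambdaR R H₁ ℓ₁ n * lambdaR R H₂ ℓ₂ n =
      ((#H₁ + ℓ₁).factorial : ℝ)⁻¹ * ((#H₂ + ℓ₂).factorial : ℝ)⁻¹ *
        ∑ de ∈ Icc 1 ⌊R⌋₊ ×ˢ Icc 1 ⌊R⌋₊,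
          if de.1 ∣ tuplePoly H₁ n ∧ de.2 ∣ tuplePoly H₂ n then
            (μ de.1 : ℝ) * (μ de.2 : ℝ) * Real.log (R / de.1) ^ (#H₁ + ℓ₁) *
              Real.log (R / de.2) ^ (#H₂ + ℓ₂) else 0 := by
  unfold lambdaR
  rw [divisors_filter_eq H₁ hn R, divisors_filter_eq H₂ hn R, Finset.sum_filter, Finset.sum_filter]
  rw [mul_mul_mul_comm, Finset.sum_mul_sum, ← Finset.sum_product']
  congr 1
  refine Finset.sum_congr rfl fun de _ => ?_
  by_cases h1 : de.1 ∣ tuplePoly H₁ n <;> by_cases h2 : de.2 ∣ tuplePoly H₂ n <;>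
    simp [h1, h2]
  ring

/-- **GPY (7.3)**: `S_R(N; H₁, H₂, ℓ₁, ℓ₂) := ∑_{n ≤ N} Λ_R(n; H₁, ℓ₁) Λ_R(n; H₂, ℓ₂) =
(1/((k₁+ℓ₁)!(k₂+ℓ₂)!)) ∑_{d, e ≤ R} μ(d)μ(e)(log R/d)^{k₁+ℓ₁}(log R/e)^{k₂+ℓ₂}`
`· ∑_{n ≤ N, d∣P_{H₁}(n), e∣P_{H₂}(n)} 1`.
[cite: GoldstonPintzYildirim2009, Section 7 eq. 7.3] -/
theorem sum_lambdaR_mul_eq (R : ℝ) (H₁ H₂ : Finset ℕ) (ℓ₁ ℓ₂ N : ℕ) :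
    ∑ n ∈ Icc 1 N, lambdaR R H₁ ℓ₁ n * lambdaR R H₂ ℓ₂ n =
      ((#H₁ + ℓ₁).factorial : ℝ)⁻¹ * ((#H₂ + ℓ₂).factorial : ℝ)⁻¹ *
        ∑ de ∈ Icc 1 ⌊R⌋₊ ×ˢ Icc 1 ⌊R⌋₊,
          (μ de.1 : ℝ) * (μ de.2 : ℝ) * Real.log (R / de.1) ^ (#H₁ + ℓ₁) *
            Real.log (R / de.2) ^ (#H₂ + ℓ₂) *
            #((Icc 1 N).filter fun n => de.1 ∣ tuplePoly H₁ n ∧ de.2 ∣ tuplePoly H₂ n) := by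
  rw [Finset.sum_congr rfl fun n hn => lambdaR_mul_lambdaR_eq R H₁ H₂ ℓ₁ ℓ₂ (Finset.mem_Icc.1 hn).1,
    ← Finset.mul_sum, Finset.sum_comm]
  congr 1
  refine Finset.sum_congr rfl fun de _ => ?_
  rw [← Finset.sum_filter, Finset.sum_const, nsmul_eq_mul, mul_comm]

/-- The main term `T_R(ℓ₁, ℓ₂; H₁, H₂)` of (7.6)/(7.7), written over pairs `(d, e)`:
`(1/((k₁+ℓ₁)!(k₂+ℓ₂)!)) ∑_{d, e ≤ R} μ(d)μ(e) (log R/d)^{k₁+ℓ₁} (log R/e)^{k₂+ℓ₂}`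
`· nuJoint(d,e)/[d,e]`;
by `nuJoint_eq`, `[d, e] = a₁a₂a₁₂` and `μ(d)μ(e) = μ(a₁)μ(a₂)μ(a₁₂)²` this is the printed primed
sum over pairwise coprime `(a₁, a₂, a₁₂)` with `a₁a₁₂ ≤ R`, `a₂a₁₂ ≤ R` ((7.6); (7.7) rewrites it
as a double contour integral). [cite: GoldstonPintzYildirim2009, Section 7 eq. 7.6] -/
def mainTR₂ (R : ℝ) (H₁ H₂ : Finset ℕ) (ℓ₁ ℓ₂ : ℕ) : ℝ :=
  ((#H₁ + ℓ₁).factorial : ℝ)⁻¹ * ((#H₂ + ℓ₂).factorial : ℝ)⁻¹ *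
    ∑ de ∈ Icc 1 ⌊R⌋₊ ×ˢ Icc 1 ⌊R⌋₊,
      (μ de.1 : ℝ) * (μ de.2 : ℝ) * Real.log (R / de.1) ^ (#H₁ + ℓ₁) *
        Real.log (R / de.2) ^ (#H₂ + ℓ₂) * (nuJoint H₁ H₂ de.1 de.2 / Nat.lcm de.1 de.2 : ℝ)

/-- **GPY (7.6)**, explicit: `|S_R(N; H₁,H₂,ℓ₁,ℓ₂) − N T_R(ℓ₁,ℓ₂; H₁,H₂)| ≤
((log R)^{k₁+ℓ₁+k₂+ℓ₂}/((k₁+ℓ₁)!(k₂+ℓ₂)!)) (∑♭_{q ≤ R} d_k(q))²`, `k = k₁ + k₂ ≥ 1`, from (7.4),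
`nuJoint ≤ d_k(d) d_k(e)`, `|μ| ≤ 1`, `0 ≤ log(R/d) ≤ log R` (`R ≥ 1`).
[cite: GoldstonPintzYildirim2009, Section 7 eq. 7.6] -/
theorem abs_sum_lambdaR_mul_sub_le {R : ℝ} (hR : 1 ≤ R) (H₁ H₂ : Finset ℕ) (hk : 1 ≤ #H₁ + #H₂)
    (ℓ₁ ℓ₂ N : ℕ) :
    |∑ n ∈ Icc 1 N, lambdaR R H₁ ℓ₁ n * lambdaR R H₂ ℓ₂ n - N * mainTR₂ R H₁ H₂ ℓ₁ ℓ₂| ≤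
      ((#H₁ + ℓ₁).factorial : ℝ)⁻¹ * ((#H₂ + ℓ₂).factorial : ℝ)⁻¹ *
        Real.log R ^ (#H₁ + ℓ₁ + (#H₂ + ℓ₂)) * sumDGen R (#H₁ + #H₂) ^ 2 := by
  rw [sum_lambdaR_mul_eq, mainTR₂, mul_left_comm (N : ℝ), ← mul_sub, Finset.mul_sum,
    ← Finset.sum_sub_distrib, abs_mul, abs_of_nonneg (by positivity)]
  suffices key : |∑ de ∈ Icc 1 ⌊R⌋₊ ×ˢ Icc 1 ⌊R⌋₊,
      ((μ de.1 : ℝ) * (μ de.2 : ℝ) * Real.log (R / de.1) ^ (#H₁ + ℓ₁) *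
          Real.log (R / de.2) ^ (#H₂ + ℓ₂) *
          #((Icc 1 N).filter fun n => de.1 ∣ tuplePoly H₁ n ∧ de.2 ∣ tuplePoly H₂ n) -
        N * ((μ de.1 : ℝ) * (μ de.2 : ℝ) * Real.log (R / de.1) ^ (#H₁ + ℓ₁) *
          Real.log (R / de.2) ^ (#H₂ + ℓ₂) * (nuJoint H₁ H₂ de.1 de.2 / Nat.lcm de.1 de.2 : ℝ)))| ≤
      Real.log R ^ (#H₁ + ℓ₁ + (#H₂ + ℓ₂)) * sumDGen R (#H₁ + #H₂) ^ 2 by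
    calc _ ≤ ((#H₁ + ℓ₁).factorial : ℝ)⁻¹ * ((#H₂ + ℓ₂).factorial : ℝ)⁻¹ *
          (Real.log R ^ (#H₁ + ℓ₁ + (#H₂ + ℓ₂)) * sumDGen R (#H₁ + #H₂) ^ 2) :=
          mul_le_mul_of_nonneg_left key (by positivity)
      _ = _ := by ring
  have hlogR : 0 ≤ Real.log R := Real.log_nonneg hR
  -- termwise bound
  have hterm : ∀ de ∈ Icc 1 ⌊R⌋₊ ×ˢ Icc 1 ⌊R⌋₊,
      |(μ de.1 : ℝ) * (μ de.2 : ℝ) * Real.log (R / de.1) ^ (#H₁ + ℓ₁) *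
          Real.log (R / de.2) ^ (#H₂ + ℓ₂) *
          #((Icc 1 N).filter fun n => de.1 ∣ tuplePoly H₁ n ∧ de.2 ∣ tuplePoly H₂ n) -
        N * ((μ de.1 : ℝ) * (μ de.2 : ℝ) * Real.log (R / de.1) ^ (#H₁ + ℓ₁) *
          Real.log (R / de.2) ^ (#H₂ + ℓ₂) * (nuJoint H₁ H₂ de.1 de.2 / Nat.lcm de.1 de.2 : ℝ))| ≤
      Real.log R ^ (#H₁ + ℓ₁ + (#H₂ + ℓ₂)) *
        ((if Squarefree de.1 then dGen ((#H₁ : ℝ) + #H₂) de.1 else 0) *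
          (if Squarefree de.2 then dGen ((#H₁ : ℝ) + #H₂) de.2 else 0)) := by
    rintro ⟨d, e⟩ hde
    obtain ⟨hd, he⟩ := Finset.mem_product.1 hde
    obtain ⟨hd1, hdR⟩ := Finset.mem_Icc.1 hd
    obtain ⟨he1, heR⟩ := Finset.mem_Icc.1 he
    dsimp only
    by_cases hsd : Squarefree d
    · by_cases hse : Squarefree e
      · rw [if_pos hsd, if_pos hse]
        have hd0 : (0 : ℝ) < d := by exact_mod_cast hd1
        have he0 : (0 : ℝ) < e := by exact_mod_cast he1
        have hRR : (⌊R⌋₊ : ℝ) ≤ R := Nat.floor_le (by linarith)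
        have hdR' : (d : ℝ) ≤ R := le_trans (by exact_mod_cast hdR) hRR
        have heR' : (e : ℝ) ≤ R := le_trans (by exact_mod_cast heR) hRR
        have hfac : (μ d : ℝ) * (μ e : ℝ) * Real.log (R / d) ^ (#H₁ + ℓ₁) *
            Real.log (R / e) ^ (#H₂ + ℓ₂) *
            #((Icc 1 N).filter fun n => d ∣ tuplePoly H₁ n ∧ e ∣ tuplePoly H₂ n) -
            N * ((μ d : ℝ) * (μ e : ℝ) * Real.log (R / d) ^ (#H₁ + ℓ₁) *
              Real.log (R / e) ^ (#H₂ + ℓ₂) * (nuJoint H₁ H₂ d e / Nat.lcm d e : ℝ)) =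
            ((μ d : ℝ) * (μ e : ℝ)) * (Real.log (R / d) ^ (#H₁ + ℓ₁) *
              Real.log (R / e) ^ (#H₂ + ℓ₂)) *
              ((#((Icc 1 N).filter fun n => d ∣ tuplePoly H₁ n ∧ e ∣ tuplePoly H₂ n) : ℝ) -
                nuJoint H₁ H₂ d e * ((N : ℝ) / Nat.lcm d e)) := by ring
        rw [hfac, abs_mul, abs_mul]
        have hμ : |(μ d : ℝ) * (μ e : ℝ)| ≤ 1 := by
          rw [abs_mul]
          have h1 : |(μ d : ℝ)| ≤ 1 := by
            rw [← Int.cast_abs]; exact_mod_cast ArithmeticFunction.abs_moebius_le_one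
          have h2 : |(μ e : ℝ)| ≤ 1 := by
            rw [← Int.cast_abs]; exact_mod_cast ArithmeticFunction.abs_moebius_le_one
          exact mul_le_one₀ h1 (abs_nonneg _) h2
        have hl1 : 0 ≤ Real.log (R / d) := Real.log_nonneg ((one_le_div hd0).2 hdR')
        have hl2 : 0 ≤ Real.log (R / e) := Real.log_nonneg ((one_le_div he0).2 heR')
        have hl1' : Real.log (R / d) ≤ Real.log R := by
          rw [Real.log_div (by linarith) hd0.ne']
          linarith [Real.log_nonneg (show (1 : ℝ) ≤ d by exact_mod_cast hd1)]
        have hl2' : Real.log (R / e) ≤ Real.log R := by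
          rw [Real.log_div (by linarith) he0.ne']
          linarith [Real.log_nonneg (show (1 : ℝ) ≤ e by exact_mod_cast he1)]
        have hpow : |Real.log (R / d) ^ (#H₁ + ℓ₁) * Real.log (R / e) ^ (#H₂ + ℓ₂)| ≤
            Real.log R ^ (#H₁ + ℓ₁ + (#H₂ + ℓ₂)) := by
          rw [abs_of_nonneg (by positivity),
            show Real.log R ^ (#H₁ + ℓ₁ + (#H₂ + ℓ₂)) =
              Real.log R ^ (#H₁ + ℓ₁) * Real.log R ^ (#H₂ + ℓ₂) from pow_add _ _ _]
          exact mul_le_mul (pow_le_pow_left₀ hl1 hl1' _) (pow_le_pow_left₀ hl2 hl2' _)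
            (by positivity) (by positivity)
        have hcount := abs_card_filter_dvd_and_sub_le hsd hse H₁ H₂ N
        have hν := nuJoint_le H₁ H₂ hk hsd.ne_zero hse.ne_zero
        calc |(μ d : ℝ) * (μ e : ℝ)| *
              |Real.log (R / d) ^ (#H₁ + ℓ₁) * Real.log (R / e) ^ (#H₂ + ℓ₂)| *
              |(#((Icc 1 N).filter fun n => d ∣ tuplePoly H₁ n ∧ e ∣ tuplePoly H₂ n) : ℝ) -
                nuJoint H₁ H₂ d e * ((N : ℝ) / Nat.lcm d e)|
            ≤ 1 * Real.log R ^ (#H₁ + ℓ₁ + (#H₂ + ℓ₂)) * nuJoint H₁ H₂ d e := by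
              apply mul_le_mul (mul_le_mul hμ hpow (abs_nonneg _) zero_le_one) hcount
                (abs_nonneg _) (by positivity)
          _ ≤ Real.log R ^ (#H₁ + ℓ₁ + (#H₂ + ℓ₂)) *
                (dGen ((#H₁ : ℝ) + #H₂) d * dGen ((#H₁ : ℝ) + #H₂) e) := by
              rw [one_mul]
              refine mul_le_mul_of_nonneg_left ?_ (by positivity)
              exact_mod_cast hν
      · have hμ0 : (μ e : ℝ) = 0 := by
          exact_mod_cast ArithmeticFunction.moebius_eq_zero_of_not_squarefree hse
        rw [hμ0, if_neg hse]
        simp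
    · have hμ0 : (μ d : ℝ) = 0 := by
        exact_mod_cast ArithmeticFunction.moebius_eq_zero_of_not_squarefree hsd
      rw [hμ0, if_neg hsd]
      simp
  calc |∑ de ∈ Icc 1 ⌊R⌋₊ ×ˢ Icc 1 ⌊R⌋₊, _| ≤ ∑ de ∈ Icc 1 ⌊R⌋₊ ×ˢ Icc 1 ⌊R⌋₊, |_| :=
        Finset.abs_sum_le_sum_abs _ _
    _ ≤ ∑ de ∈ Icc 1 ⌊R⌋₊ ×ˢ Icc 1 ⌊R⌋₊, Real.log R ^ (#H₁ + ℓ₁ + (#H₂ + ℓ₂)) *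
          ((if Squarefree de.1 then dGen ((#H₁ : ℝ) + #H₂) de.1 else 0) *
            (if Squarefree de.2 then dGen ((#H₁ : ℝ) + #H₂) de.2 else 0)) :=
        Finset.sum_le_sum hterm
    _ = Real.log R ^ (#H₁ + ℓ₁ + (#H₂ + ℓ₂)) * sumDGen R (#H₁ + #H₂) ^ 2 := by
        rw [← Finset.mul_sum]
        congr 1
        rw [sq, sumDGen, squarefreeLE, Finset.sum_filter, Finset.sum_mul_sum, Finset.sum_product]

/-- **GPY (7.6)** with Lemma 2, (5.12) (`Literature.NumberTheory.Sieve.GPY.sumDGen_le`): for `R ≥ 1` and `k = k₁ + k₂ ≥ 1`,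
`|S_R − N T_R| ≤ ((log R)^{k₁+ℓ₁+k₂+ℓ₂}/((k₁+ℓ₁)!(k₂+ℓ₂)!)) (R (k + log R)^k)²`, an explicit form of
the printed `S_R = N T_R + O(R² (3 log R)^{3k+M})`.
[cite: GoldstonPintzYildirim2009, Section 7 eq. 7.6] -/
theorem abs_sum_lambdaR_mul_sub_le' {R : ℝ} (hR : 1 ≤ R) (H₁ H₂ : Finset ℕ) (hk : 1 ≤ #H₁ + #H₂)
    (ℓ₁ ℓ₂ N : ℕ) :
    |∑ n ∈ Icc 1 N, lambdaR R H₁ ℓ₁ n * lambdaR R H₂ ℓ₂ n - N * mainTR₂ R H₁ H₂ ℓ₁ ℓ₂| ≤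
      ((#H₁ + ℓ₁).factorial : ℝ)⁻¹ * ((#H₂ + ℓ₂).factorial : ℝ)⁻¹ *
        Real.log R ^ (#H₁ + ℓ₁ + (#H₂ + ℓ₂)) *
          (R * (((#H₁ + #H₂ : ℕ) : ℝ) + Real.log R) ^ (#H₁ + #H₂)) ^ 2 := by
  refine (abs_sum_lambdaR_mul_sub_le hR H₁ H₂ hk ℓ₁ ℓ₂ N).trans ?_
  apply mul_le_mul_of_nonneg_left _ (mul_nonneg (by positivity) (pow_nonneg (Real.log_nonneg hR) _))
  have hkpos : (0 : ℝ) < ((#H₁ + #H₂ : ℕ) : ℝ) := by exact_mod_cast hk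
  have h := sumDGen_le hkpos hR
  rw [Nat.ceil_natCast] at h
  have h0 : 0 ≤ sumDGen R ((#H₁ + #H₂ : ℕ) : ℝ) :=
    Finset.sum_nonneg fun q _ => pow_nonneg (by positivity) _
  push_cast at h h0 ⊢
  exact pow_le_pow_left₀ h0 h 2

end Literature.NumberTheory.Sieve.GPY
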